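import Literature.Topology.FourManifolds.SegTwo
import Literature.Topology.FourManifolds.RailNormalForm
import Literature.Topology.FourManifolds.BandSumConcordanceNormalRegular
import HarnessLib

/-!
# Schubert's theorem for rail knots: the heart of the well-definedness of the connected sum

Topic `Literature/Topology/FourManifolds` (trunk T-4MAN). Fact seat
`provefact-Literature.Topology.FourManifolds.Knot.IsConnectedSum.isIsotopic` (Schubert's theorem).
The assembly of the sequel files of `RailNormalForm.lean`: for two presentations `b`, `b'` of band
sums of the same summands `A` (north), `B` (south) in normal position, the rail knots are isotopic
(`BandData.railHeart_regular`, for regular presentations — the printed setting — using the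
proved band fact `BandData.isIsotopic_of_band_eq_of_isRegular_holds` for the transports). Proof: with the
transports `c` of `b` and `c'` of `b'` (`TransportData.lean`) and flat scales for the flip pairs
`(b, c)` and `(c', b')` (`FlatHost.exists_flatHyp`):

`R ∘ rail_b ≃ R ∘ bent_b ≃ bentᶜ` (`FrameC.isIsotopic_bentC_map`: first segment conjugation and
the transported frame) `≃ bent_{c'}` (`SegTwo.isIsotopic_bentC_bentRail`: third conjugation, model
bridge, twist, identification of the host, second conjugation, second twist)
`≃ rail_{c'} ≃ R ∘ K' ≃ R ∘ rail_{b'}` (spiked knots; the regular band fact for the regular transport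
and for `b'`).

Hence **Schubert's theorem in normal position for regular presentations**
(`Knot.Schubert1949_normalPosition_regular_holds`) and **the printed form of the well-definedness
of the connected sum reduced to Alexander's theorem alone**
(`Knot.IsRegularConnectedSum.isIsotopic_of_ball`, from
`Knot.IsRegularConnectedSum.isIsotopic_of_ball_of_regular_band_eq_of_rail`).

Everything is proved; no named facts are introduced.

## References

* H. Schubert, *Die eindeutige Zerlegbarkeit eines Knotens in Primknoten*, S.-B. Heidelberger
  Akad. Wiss. Math.-Nat. Kl. 1949 (3), 57–104, Satz 1 (p. 62). [Schubert1949]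
* P. R. Cromwell, *Knots and Links*, CUP (2004), §4.6 (PDF p. 69). [Cromwell2004]
* M. W. Hirsch, *Differential Topology*, GTM 33 (1976), Ch. 8 §1, Thm. 1.3. [HirschDT1976]
-/

open scoped Manifold ContDiff Topology Real
open Function Set Metric Filter

noncomputable section

namespace Literature.Topology.FourManifolds

/-- Local notation: `𝔼 n` is the model Euclidean space `EuclideanSpace ℝ (Fin n)`. -/
local notation "𝔼 " n:arg => EuclideanSpace ℝ (Fin n)

/-- Local notation: `𝕊 n` is the unit sphere in `EuclideanSpace ℝ (Fin (n + 1))`. -/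
local notation "𝕊 " n:arg => (Metric.sphere (0 : EuclideanSpace ℝ (Fin (n + 1))) 1)

attribute [local instance] fact_finrank_euclideanSpace_succ

open KnotsInBall ExitBend SegmentConj ModelTemplate TwistPath

namespace BandData

/-- **The rail bent knot is isotopic to the rail knot** (`rail ≃ spiked = frame knot ≃ bent`).
[cite: HirschDT1976, Ch. 8 §1, Thm. 1.3] -/
theorem HostHyp.isIsotopic_wallRef_bent_railKnot {A B K : Knot} {b : BandData A B K ∅}
    {hcross : b.band ⁻¹' sphereEquator 2 ∩ squareNhd b.δ = {x ∈ squareNhd b.δ | x 0 = 2⁻¹}}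
    {ε r A' κ : ℝ} (P : b.HostHyp hcross ε r A' κ (1 / 2) (1 / 8)) {lam₀ rA : ℝ} (hl₀ : lam₀ ∈ Ioc (0 : ℝ) 1) (hrA : 0 < rA) :
    (P.wallRef.bent hl₀ hrA).IsIsotopic (b.railKnot P.hAB) := by
  have h1 := b.isIsotopic_railKnot_spikeKnot P.HU.cone.spike P.hAB
  have h2 := b.isIsotopic_frameKnot_bentKnot P.HU P.hW hl₀ hrA P.hB P.hAB
  exact IsAmbientIsotopic.symm_holds (IsAmbientIsotopic.trans_holds h1 h2)

/-- **The transport of a regular presentation is regular.** [folklore] -/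
theorem IsTransport.isRegular {A B K : Knot} {b : BandData A B K ∅}
    {bt : BandData (B.map (reflectLastDiffeo 3)) (A.map (reflectLastDiffeo 3)) (K.map (reflectLastDiffeo 3)) ∅}
    (ht : b.IsTransport bt) (hreg : b.IsRegular) (hAB : Disjoint (range A) (range B)) : bt.IsRegular := by
  have h1 : (b.halfTurn hAB).IsRegular := hreg.of_band_eq_halfTurn (b.halfTurn_band hAB) (b.halfTurn_δ hAB)
  refine h1.of_band_eq_comp (reflectLastDiffeo 3) ?_ ?_
  · funext x
    rw [ht.band_eq x, comp_apply, halfTurn_band, coe_reflectLastDiffeo]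
  · rw [ht.δ_eq, halfTurn_δ]

/-- **SCHUBERT'S THEOREM FOR RAIL KNOTS, REFLECTED**: for two presentations in normal position of
band sums of `A` (north) and `B` (south), the second one regular, `R ∘ rail_b ≃ R ∘ rail_{b'}`.
[cite: Schubert1949, Satz 1 (p. 62); Cromwell2004, §4.6 (PDF p. 69)] -/
theorem railHeart_map {A B K K' : Knot} (b : BandData A B K ∅) (b' : BandData A B K' ∅)
    (hA : A.InNorth) (hB : B.InSouth) (hreg' : b'.IsRegular)
    (hcross : b.band ⁻¹' sphereEquator 2 ∩ squareNhd b.δ = {x ∈ squareNhd b.δ | x 0 = 2⁻¹})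
    (hcross' : b'.band ⁻¹' sphereEquator 2 ∩ squareNhd b'.δ = {x ∈ squareNhd b'.δ | x 0 = 2⁻¹}) :
    ((b.railKnot (Knot.disjoint_range_of_inNorth_inSouth hA hB)).map (reflectLastDiffeo 3)).IsIsotopic
      ((b'.railKnot (Knot.disjoint_range_of_inNorth_inSouth hA hB)).map (reflectLastDiffeo 3)) := by
  have hAB := Knot.disjoint_range_of_inNorth_inSouth hA hB
  -- transports and hemispheres
  obtain ⟨c, htc⟩ := b.exists_isTransport hAB
  obtain ⟨c', htc'⟩ := b'.exists_isTransport hAB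
  have hcrossc₀ := htc.cross_eq hcross
  have hcrossc := htc'.cross_eq hcross'
  have hA' : (B.map (reflectLastDiffeo 3)).InNorth := hB.map_reflectLast
  have hB' : (A.map (reflectLastDiffeo 3)).InSouth := hA.map_reflectLast
  have hAB' : Disjoint (range (B.map (reflectLastDiffeo 3))) (range (A.map (reflectLastDiffeo 3))) :=
    Knot.disjoint_range_of_inNorth_inSouth hA' hB'
  have pair : IsFlipPair b c := htc.isFlipPair.symm
  have pair' : IsFlipPair c' b' := htc'.isFlipPair
  -- flat scales for both pairs, flatness, turning and template smallness
  obtain ⟨ε, r, A', εc, rc, ε', r', κ₀, hκ₀, Hfam⟩ := exists_flatHyp (hcross₁ := hcross) (hcross₂ := hcrossc₀) pair hA hB hAB hB'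
  obtain ⟨ε₁, r₁, A₁', ε₂, r₂, ε₁', r₁', κ₀', hκ₀', H₁fam⟩ := exists_flatHyp (hcross₁ := hcrossc) (hcross₂ := hcross') pair' hA' hB' hAB' hB
  obtain ⟨rf, hf⟩ := b.exists_isFlat hcross (ε := HostHyp.epsU) HostHyp.epsU_pos
  obtain ⟨rf', hf'⟩ := c'.exists_isFlat hcrossc (ε := HostHyp.epsU) HostHyp.epsU_pos
  obtain ⟨κs, hκs, hsm⟩ := IsFlipPair.exists_small (b₁ := c') hcrossc c'.depthSign
  have htL := tgtLip_pos
  have hrf0 := hf.r_pos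
  have hrf0' := hf'.r_pos
  -- the scales
  let κ : ℝ := min κ₀ (min (rf / 8) (1 / tgtLip))
  have hκpos : 0 < κ := lt_min hκ₀ (lt_min (by positivity) (by positivity))
  have hκle : κ ≤ κ₀ := min_le_left _ _
  have hκr : 4 * κ < rf := by
    have : κ ≤ rf / 8 := (min_le_right _ _).trans (min_le_left _ _)
    linarith
  have hκt : κ * tgtLip ≤ 1 := by
    have : κ ≤ 1 / tgtLip := (min_le_right _ _).trans (min_le_right _ _)
    rwa [le_div_iff₀ htL] at this
  let κ₁ : ℝ := min κ₀' (min (rf' / 8) (min (1 / tgtLip) κs))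
  have hκ₁pos : 0 < κ₁ := lt_min hκ₀' (lt_min (by positivity) (lt_min (by positivity) hκs))
  have hκ₁le : κ₁ ≤ κ₀' := min_le_left _ _
  have hκ₁r : 4 * κ₁ < rf' := by
    have : κ₁ ≤ rf' / 8 := (min_le_right _ _).trans (min_le_left _ _)
    linarith
  have hκ₁t : κ₁ * tgtLip ≤ 1 := by
    have : κ₁ ≤ 1 / tgtLip := (min_le_right _ _).trans ((min_le_right _ _).trans (min_le_left _ _))
    rwa [le_div_iff₀ htL] at this
  have hκ₁s : |κ₁| ≤ κs := by
    rw [abs_of_pos hκ₁pos]; exact (min_le_right _ _).trans ((min_le_right _ _).trans (min_le_right _ _))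
  have Hb : FlatHyp hcross hcrossc₀ ε r A' εc rc ε' r' κ := Hfam κ hκpos hκle
  have Hball : ∀ κ', 0 < κ' → κ' ≤ κ → FlatHyp hcross hcrossc₀ ε r A' εc rc ε' r' κ' := fun κ' h1 h2 ↦ Hfam κ' h1 (h2.trans hκle)
  have H₁ : FlatHyp hcrossc hcross' ε₁ r₁ A₁' ε₂ r₂ ε₁' r₁' κ₁ := H₁fam κ₁ hκ₁pos hκ₁le
  have H₁all : ∀ κ', 0 < κ' → κ' ≤ κ₁ → FlatHyp hcrossc hcross' ε₁ r₁ A₁' ε₂ r₂ ε₁' r₁' κ' := fun κ' h1 h2 ↦ H₁fam κ' h1 (h2.trans hκ₁le)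
  have hsmall : ∀ s, ‖κ₁ • c'.frame hcrossc (template c'.depthSign s)‖ ≤ 1 / 2 := hsm κ₁ hκ₁s
  have hεf : HostHyp.epsU ≤ HostHyp.epsU := le_rfl
  -- the segment data of the first and third conjugations, far radii and thresholds
  let D₁ := FlatHyp.segData₁ Hb H₁ hf hεf hκr hκt
  let D₃ := FlatHyp.segData₃ Hb H₁ Hball H₁all hsmall
  obtain ⟨R₁, hR₁, hfar₁⟩ := exists_far_radius Hb.hostHyp pair' H₁.HU H₁.arc H₁.pairScale H₁.flat H₁.eps_le H₁.five_lt
  obtain ⟨R₃, hR₃, hfar₃⟩ := FlatHyp.exists_far_radius₃ Hb H₁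
  obtain ⟨ρm₁, hρm₁, hth₁⟩ := WallRef.UnitScale.exists_thresholds D₁ hR₁
  obtain ⟨ρm₃, hρm₃, hth₃⟩ := WallRef.UnitScale.exists_thresholds D₃ hR₃
  let ρ₂ : ℝ := min (1 / 4) (min ρm₁ ρm₃)
  have hρ₂ : 0 < ρ₂ := lt_min (by norm_num) (lt_min hρm₁ hρm₃)
  have hρ4 : ρ₂ ≤ 1 / 4 := min_le_left _ _
  obtain ⟨R₀₁, hR₀₁, rc₁, hS₁fam⟩ := hth₁ ρ₂ hρ₂ ((min_le_right _ _).trans (min_le_left _ _))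
  obtain ⟨R₀₃, hR₀₃, rc₃, hS₃fam⟩ := hth₃ ρ₂ hρ₂ ((min_le_right _ _).trans (min_le_right _ _))
  -- the twist threshold of the third output (independent of the unit radius)
  have hL' := FlatHyp.L₁_d Hb H₁ Hball H₁all hsmall hf hεf hκr hκt
  have hdet := FlatHyp.det_L₁_pos Hb H₁ hf hεf hκr hκt
  obtain ⟨lamp, rAp, Up⟩ := (Hb.wallRef FlatHyp.zero_mem01).exists_unitScale hρ₂ hR₀₃
  have hS₃p := hS₃fam R₀₃ hR₀₃ le_rfl
  let T : ℝ := (Up.twData D₃ hS₃p hL' hdet).R₀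
  have hT : 0 < T := TwData.R₀_pos _
  -- norms
  let NL₁ : ℝ := ‖((D₁.L : (𝔼 3) ≃L[ℝ] 𝔼 3) : (𝔼 3) →L[ℝ] 𝔼 3)‖
  let NL₃ : ℝ := ‖((D₃.L : (𝔼 3) ≃L[ℝ] 𝔼 3) : (𝔼 3) →L[ℝ] 𝔼 3)‖
  let Nf : ℝ := ‖(((b'.frame hcross').symm : (𝔼 3) ≃L[ℝ] 𝔼 3) : (𝔼 3) →L[ℝ] 𝔼 3)‖
  have hNL₁0 : 0 ≤ NL₁ := norm_nonneg _
  have hNL₃0 : 0 ≤ NL₃ := norm_nonneg _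
  have hNf0 : 0 ≤ Nf := norm_nonneg _
  have hco : ‖chordO H₁.arc‖ < 2 := norm_chordLine_lt_two H₁.arc H₁.hB₂ (v := 2) ⟨by norm_num, by norm_num⟩
  -- the unit radius
  let R₀ : ℝ := min (min R₀₁ R₀₃) (min (T / (NL₃ + 1)) (min (κ₁ / (16 * (Nf * NL₁ + 1))) ((2 - ‖chordO H₁.arc‖) / (2 * (NL₁ + 1)))))
  have hd1 : 0 < NL₃ + 1 := by linarith
  have hd2 : 0 < 16 * (Nf * NL₁ + 1) := by nlinarith [mul_nonneg hNf0 hNL₁0]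
  have hd3 : 0 < 2 * (NL₁ + 1) := by linarith
  have hR₀ : 0 < R₀ := lt_min (lt_min hR₀₁ hR₀₃) (lt_min (div_pos hT hd1) (lt_min (div_pos hκ₁pos hd2) (div_pos (by linarith) hd3)))
  have e1 : R₀ ≤ R₀₁ := (min_le_left _ _).trans (min_le_left _ _)
  have e3 : R₀ ≤ R₀₃ := (min_le_left _ _).trans (min_le_right _ _)
  have eT : R₀ ≤ T / (NL₃ + 1) := (min_le_right _ _).trans (min_le_left _ _)
  have eK : R₀ ≤ κ₁ / (16 * (Nf * NL₁ + 1)) := (min_le_right _ _).trans ((min_le_right _ _).trans (min_le_left _ _))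
  have eC : R₀ ≤ (2 - ‖chordO H₁.arc‖) / (2 * (NL₁ + 1)) := (min_le_right _ _).trans ((min_le_right _ _).trans (min_le_right _ _))
  have hS₁ := hS₁fam R₀ hR₀ e1
  have hS₃ := hS₃fam R₀ hR₀ e3
  obtain ⟨lam₀, rA, U⟩ := (Hb.wallRef FlatHyp.zero_mem01).exists_unitScale hρ₂ hR₀
  have hR0 : NL₃ * R₀ ≤ (U.twData D₃ hS₃ hL' hdet).R₀ := by
    have e : (U.twData D₃ hS₃ hL' hdet).R₀ = T := rfl
    rw [e]
    rw [le_div_iff₀ hd1] at eT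
    nlinarith [mul_nonneg hNL₃0 hR₀.le]
  have hL1 : Nf * (NL₁ * R₀) ≤ κ₁ / 16 := by
    rw [le_div_iff₀ hd2] at eK
    have h0 : 0 ≤ Nf * NL₁ := mul_nonneg hNf0 hNL₁0
    rw [le_div_iff₀ (by norm_num : (0 : ℝ) < 16)]
    nlinarith [mul_nonneg h0 hR₀.le]
  have hL2 : ‖chordO H₁.arc‖ + NL₁ * R₀ < 2 := by
    rw [le_div_iff₀ hd3] at eC
    nlinarith [mul_nonneg hNL₁0 hR₀.le]
  -- the transported frame is a clear wall frame
  have hW := (U.toRail Hb).isWallFrame_frameC hf hεf hκr hκt pair' H₁.HU H₁.arc H₁.pairScale H₁.flat H₁.eps_le H₁.five_lt hρ4 hfar₁ hS₁ hL1 hL2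
  have hclear := (U.toRail Hb).isBendClear_frameC hf hεf hκr hκt pair' H₁.HU H₁.arc H₁.pairScale H₁.flat H₁.eps_le H₁.five_lt hρ4 hfar₁ hS₁ hL1 hL2
  have hBA : B = (B.map (reflectLastDiffeo 3)).map (reflectLastDiffeo 3) := (map_reflectLast_map_reflectLast B).symm
  -- the second conjugation on `c'`
  obtain ⟨R₂, hR₂, hfar₂⟩ := H₁.hostHyp.wallRef.exists_far_radius_host
  let D₂ := FlatHyp.segData₂ Hb H₁ Hball H₁all hsmall hf hεf hκr hκt U hρ4 hfar₁ hS₁ hfar₃ hS₃ hR0 hW hclear hBA hf' hεf hκ₁r hκ₁t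
  obtain ⟨ρm₂, hρm₂, hth₂⟩ := WallRef.UnitScale.exists_thresholds D₂ hR₂
  let ρ₂' : ℝ := min (1 / 4) ρm₂
  have hρ₂' : 0 < ρ₂' := lt_min (by norm_num) hρm₂
  have hρ4' : ρ₂' ≤ 1 / 4 := min_le_left _ _
  obtain ⟨R₀₂, hR₀₂, rc₂, hS₂fam⟩ := hth₂ ρ₂' hρ₂' (min_le_right _ _)
  obtain ⟨lamq, rAq, Uq⟩ := (FlatHyp.wallRefC Hb H₁ hf hεf hκr hκt U hρ4 hfar₁ hS₁ hW hclear).exists_unitScale hρ₂' hR₀₂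
  have hS₂q := hS₂fam R₀₂ hR₀₂ le_rfl
  let T₂ : ℝ := (FlatHyp.twData₂ Hb H₁ Hball H₁all hsmall hf hεf hκr hκt U hρ4 hfar₁ hS₁ hfar₃ hS₃ hR0 hW hclear hBA hf' hεf hκ₁r hκ₁t Uq hS₂q).R₀
  have hT₂ : 0 < T₂ := TwData.R₀_pos _
  let R₀' : ℝ := min R₀₂ T₂
  have hR₀' : 0 < R₀' := lt_min hR₀₂ hT₂
  have hS₂ := hS₂fam R₀' hR₀' (min_le_left _ _)
  obtain ⟨lam₀', rA', U₂⟩ := (FlatHyp.wallRefC Hb H₁ hf hεf hκr hκt U hρ4 hfar₁ hS₁ hW hclear).exists_unitScale hρ₂' hR₀'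
  have hR0' : R₀' ≤ (FlatHyp.twData₂ Hb H₁ Hball H₁all hsmall hf hεf hκr hκt U hρ4 hfar₁ hS₁ hfar₃ hS₃ hR0 hW hclear hBA hf' hεf hκ₁r hκ₁t U₂ hS₂).R₀ := by
    have e : (FlatHyp.twData₂ Hb H₁ Hball H₁all hsmall hf hεf hκr hκt U hρ4 hfar₁ hS₁ hfar₃ hS₃ hR0 hW hclear hBA hf' hεf hκ₁r hκ₁t U₂ hS₂).R₀ = T₂ := rfl
    rw [e]; exact min_le_right _ _
  -- THE CHAIN
  have i1 : ((b.railKnot hAB).map (reflectLastDiffeo 3)).IsIsotopic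
      ((FlatHyp.wallRefC Hb H₁ hf hεf hκr hκt U hρ4 hfar₁ hS₁ hW hclear).bent U₂.hl₀ U₂.hrA) := by
    have h := (U.toRail Hb).isIsotopic_bentC_map hf hεf hκr hκt pair' H₁.HU H₁.arc H₁.pairScale H₁.flat H₁.eps_le H₁.five_lt hρ4 hfar₁ hS₁ hW
      U₂.hl₀ U₂.hrA (Hb.hostHyp.isIsotopic_wallRef_bent_railKnot U.hl₀ U.hrA)
    exact IsAmbientIsotopic.symm_holds h
  have i2 := FlatHyp.isIsotopic_bentC_bentRail Hb H₁ Hball H₁all hsmall hf hεf hκr hκt U hρ4 hfar₁ hS₁ hfar₃ hS₃ hR0 hW hclear hBA hf' hεf hκ₁r hκ₁t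
    U₂ hρ4' hfar₂ hS₂ hR0'
  have i3 := H₁.hostHyp.isIsotopic_wallRef_bent_railKnot U₂.hl₀ U₂.hrA
  have hregc : c'.IsRegular := IsTransport.isRegular htc' hreg' hAB
  have i4 : (c'.railKnot H₁.hostHyp.hAB).IsIsotopic ((b'.railKnot hAB).map (reflectLastDiffeo 3)) :=
    IsAmbientIsotopic.trans_holds
      (IsAmbientIsotopic.symm_holds (c'.isIsotopic_railKnot_of_isRegular isIsotopic_of_band_eq_of_isRegular_holds H₁.hostHyp.hAB hregc))
      ((b'.isIsotopic_railKnot_of_isRegular isIsotopic_of_band_eq_of_isRegular_holds hAB hreg').map_congr _)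
  exact IsAmbientIsotopic.trans_holds i1 (IsAmbientIsotopic.trans_holds i2 (IsAmbientIsotopic.trans_holds i3 i4))

/-- **SCHUBERT'S THEOREM FOR RAIL KNOTS OF REGULAR PRESENTATIONS**: for regular presentations
`b`, `b'` in normal position of band sums of the same summands `A` (north) and `B` (south), the rail
knots are isotopic (in the form of the hypothesis `hR` of
`Knot.Schubert1949_normalPosition_regular_of_rail`; the regularity of `b` is not needed).
[cite: Schubert1949, Satz 1 (p. 62); Cromwell2004, §4.6 (PDF p. 69)] -/
theorem railHeart_regular :
    ∀ {A B K K' : Knot} (b : BandData A B K ∅) (b' : BandData A B K' ∅) (hA : A.InNorth) (hB : B.InSouth),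
      b.IsRegular → b'.IsRegular →
      b.band ⁻¹' sphereEquator 2 ∩ squareNhd b.δ = {x ∈ squareNhd b.δ | x 0 = 2⁻¹} →
      b'.band ⁻¹' sphereEquator 2 ∩ squareNhd b'.δ = {x ∈ squareNhd b'.δ | x 0 = 2⁻¹} →
      (b.railKnot (Knot.disjoint_range_of_inNorth_inSouth hA hB)).IsIsotopic
        (b'.railKnot (Knot.disjoint_range_of_inNorth_inSouth hA hB)) := by
  intro A B K K' b b' hA hB _ hreg' hcross hcross'
  have h := (railHeart_map b b' hA hB hreg' hcross hcross').map_congr (reflectLastDiffeo 3)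
  rwa [map_reflectLast_map_reflectLast, map_reflectLast_map_reflectLast] at h

end BandData

namespace Knot

/-- **SCHUBERT'S THEOREM IN NORMAL POSITION FOR REGULAR PRESENTATIONS** (the band fact in its
printed, regular form is a theorem of the tree: `BandData.isIsotopic_of_band_eq_of_isRegular_holds`).
[cite: Schubert1949, Satz 1 (p. 62); Cromwell2004, §4.6 (PDF p. 69)] -/
theorem Schubert1949_normalPosition_regular_holds : Schubert1949_normalPosition_regular :=
  Schubert1949_normalPosition_regular_of_rail BandData.isIsotopic_of_band_eq_of_isRegular_holds BandData.railHeart_regular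

/-- **THE PRINTED FORM OF SCHUBERT'S THEOREM — THE CONNECTED SUM OF ORIENTED KNOTS ALONG A REGULAR
BAND IS WELL DEFINED — REDUCED TO ALEXANDER'S THEOREM ALONE**: `Knot.IsRegularConnectedSum.isIsotopic`
from `SphereEmbedding.schoenflies_exists_ball`. [cite: Schubert1949, Satz 1 (p. 62); Cromwell2004, §4.6 (PDF p. 69)] -/
theorem IsRegularConnectedSum.isIsotopic_of_ball (hB : SphereEmbedding.schoenflies_exists_ball) :
    IsRegularConnectedSum.isIsotopic :=
  IsRegularConnectedSum.isIsotopic_of_ball_of_regular_band_eq_of_rail hB BandData.isIsotopic_of_band_eq_of_isRegular_holds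
    BandData.railHeart_regular

end Knot

end Literature.Topology.FourManifolds
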